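import Summits.BirchSwinnertonDyer.Rank1Residual.Partition.CornersMultSchneiderCellC
import Literature.NumberTheory.EllipticCurves.Disegni2020.PAdicBSDRankOneNonsplitDerived
import Literature.Barriers.BirchSwinnertonDyer.ExceptionalZero
import HarnessLib

/-!
# O9 (X2c), NON-SPLIT gvpar sub-cell: the per-pair Schneider certificate IS the computable bit
# `[T¹] L_p(E,T) ≠ 0` of THE non-split Mazur–Tate–Teitelbaum function (cell `b2b-bsdres`, lane
# CLASS-CLOSURE, seat `cc-typer-6`; the 'certificate-bit column' asked of cc-eng-1 in
# class-closure/O9/SUBPARTITION-typed.md §1, typed as a hypothesis SHAPE — nothing asserted, nothing booked)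

HONEST FRAMING (run/shared/lean/b2b/bsd-rank1-residual/, verbatim in every file): the goal of the
cell is to DELETE the COMBINATION-SHAPED residual classes of the Birch–Swinnerton-Dyer formula for
ALL analytic-rank `≤ 1` elliptic curves over `ℚ` — "full BSD formula for every rank `≤ 1` curve in
class `C`" assembled STRICTLY from published theorems — so that the rank-`≤ 1` remainder becomes
exactly the CONSTRUCTION-SHAPED classes, which are TYPED (missing-input `Prop`s), NOT attempted.
This is not "finishing BSD". Theorems only; NO definition, NO named fact; every published theorem
enters as one of the tree's existing named Literature facts BY NAME; the certificate is a PER-PAIR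
hypothesis (an instrument computes it; its output is EVIDENCE, never a Literature fact); nothing about
any particular curve is asserted; no label changes; X2c stays CONSTRUCTION-SHAPED until referee A rules.

## What this file records

`Partition/CornersMultSchneiderCellC.lean` (p251198) closes the sub-cell `X2.CellCNonsplitGV`
(X2c ∧ ¬split ∧ gvpar; 1 599 cells by cc-lead's gen-3 count) from PUBLISHED named facts modulo ONE
per-pair input: Schneider's non-degeneracy `SchneiderConjecture Dh` of THE Stein–Wuthrich §4.2 height
at the pair (binder `hSchN`). At a NON-SPLIT multiplicative prime in analytic rank one that input is
EQUIVALENT, granted Disegni 2020 Thm. 1 (A183 `thm1_padicBSD_rankOne_multiplicative`, non-split clause: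
`ϖ·[T¹]L·log_p γ_cyc·#T² = u·2·#Ш_an·Reg_p(E,Dh)·∏ c_v`), to the non-vanishing of the LINEAR
coefficient `[T¹]L` of THE non-split Mazur–Tate–Teitelbaum function — because every other factor is
non-zero by tree theorems: `ϖ > 0` (modular parametrisation datum), `log_p γ_cyc ≠ 0`
(`padicLog_cyclotomicGenerator_ne_zero`), `#T ≠ 0`, `u ∈ ℤ_pˣ`, `#Ш_an ≠ 0`
(`Disegni2020.shaAn_ne_zero_of_isNewformOf`, p251381), `∏ c_v > 0`. And `[T¹]L ≠ 0`, i.e.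
`ord_{T=0} L_p(E,T) = 1` (the constant term vanishes: `L(E,1) = 0`, no exceptional zero), is what
PARI's `ellpadicL(E, p, n, , 1)` certifies per pair to any precision — the X11-REPORT engine, non-split
rows. So on this sub-cell the kernel carries ONE obligation node of instrument shape:

* `X2.schneider_of_coeff_one_ne_zero_of_thm1` — pair level: `[T¹]L ≠ 0` for THE function ⟹
  `SchneiderConjecture Dh` for every §4.2 datum at the pair (A183 + modularity datum);
* `X2.coeff_one_ne_zero_of_schneider_of_thm1` — the converse bookkeeping (A183; so the bit and the
  certificate are the SAME node on these pairs);
* `X2.bsdp_of_cellC_of_not_split_of_gvPar_of_thm1_of_coeff_one_ne_zero` — **`X2.CellCNonsplitGV` ∧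
  `[T¹]L_p ≠ 0` ⟹ `BSD(E,p)`** from the published named facts of p251198 (GV00-mult `hGV` — flag
  `GV00-mult-asserted` —, Wuthrich Thm. 16 `hWu`, SW Thm. 6.1 `hJn` + §4.2 existence `hHn`, Disegni
  A183 `hD`, GZK, modularity), NO Schneider binder;
* `X2.bsdp_of_cellC_of_not_split_of_mazurMainConjectureAt_of_thm1_of_coeff_one_ne_zero` — the same
  on all of X2c ∧ ¬split given Mazur's MC at the pair (route G per pair on the ¬gvpar sub-cell).

References: [Disegni2020] Thm. 1 (§1.2) = Thm. 4 (§3.2); [MazurTateTeitelbaum1986Invent] §I.13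
(`d/ds = log_p γ · d/dT`), §II; [SteinWuthrich2013] Thm. 6.1, §4.2, §7 (the engine);
[GreenbergVatsal2000] Thm. (1.3); [Wuthrich2014] Thm. 16; class-closure/O9/SUBPARTITION-typed.md §1, §4;
cc-typer-3's X11b analogue `X11b/CensusPAdicLeadingTermBridge.lean` §3.
-/

set_option autoImplicit false

noncomputable section

open scoped Classical MatrixGroups ModularForm

open CongruenceSubgroup WeierstrassCurve Literature.NumberTheory.EllipticCurves
  Literature.NumberTheory.EllipticCurves.ModularForms
  Literature.NumberTheory.EllipticCurves.Rank1Residual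
  Literature.NumberTheory.EllipticCurves.Rank1Residual.Typed
  Literature.NumberTheory.EllipticCurves.GreenbergVatsal2000
  Literature.NumberTheory.EllipticCurves.Wuthrich2014
  Literature.NumberTheory.EllipticCurves.SteinWuthrich2013
  Literature.NumberTheory.EllipticCurves.Disegni2020

namespace Summit.BirchSwinnertonDyer.Rank1Residual.X2

variable (W : WeierstrassCurve ℚ) [W.IsElliptic] [W.IsGloballyMinimal] (p : ℕ) [Fact p.Prime]

/-- **`[T¹]L_p ≠ 0` ⟹ Schneider non-degeneracy of THE §4.2 height**, at a non-split multiplicative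
`p ≠ 2` in analytic rank one: instantiate Disegni's non-split identity (A183, `hD`) at the modular
parametrisation datum (`hpar`: newform `f`, `ϖ > 0`), THE Mazur–Tate–Teitelbaum function
(`exists_isMultPAdicLFunctionOf_neg_one_of_nonsplit`) and the given height datum; if
`Reg_p(E,Dh) = 0` the right-hand side vanishes while `ϖ·[T¹]L·log_p γ_cyc·#T² ≠ 0`. The hypothesis
`hc1` is the per-pair certificate SHAPE (THE function's linear coefficient is non-zero, for every
newform of `W` — they share one `L`); an instrument output, nothing asserted.
[cite: Disegni2020, Thm. 1 (§1.2) = Thm. 4 first bullet (§3.2)] [cite: MazurTateTeitelbaum1986Invent, §I.13]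
[cite: SteinWuthrich2013, §4.2] -/
theorem schneider_of_coeff_one_ne_zero_of_thm1 (hD : thm1_padicBSD_rankOne_multiplicative)
    (hpar : nonempty_modularParametrizationData) (hp2 : p ≠ 2)
    (hmult : W.HasMultiplicativeReductionAtPrime p) (hns : ¬ W.HasSplitMultiplicativeReductionAtPrime p)
    (hr1 : W.analyticRank = 1)
    (hc1 : ∀ {N : ℕ} [NeZero N] (f : CuspForm (Gamma0 N) 2), IsNewformOf W f →
      ∀ (L : PowerSeries ℚ_[p]), IsMultPAdicLFunctionOf f p (-1) L → PowerSeries.coeff 1 L ≠ 0)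
    {q : ℚ_[p]} (hq0 : q ≠ 0) (hq1 : ‖q‖ < 1) (hqj : tateJ q = (W.j : ℚ_[p]))
    (Dh : PAdicHeightData W p) (hDh : IsMultCanonical Dh q) : SchneiderConjecture Dh := by
  haveI : NeZero (W.conductorNorm ℤ) := ⟨(W.conductorNorm_pos_holds).ne'⟩
  obtain ⟨Dm⟩ := hpar W
  obtain ⟨ϖ, hϖpos, hϖ, -⟩ := Dm.exists_rat_mul_realPeriodRat_eq_plusPeriod
  obtain ⟨L, hL⟩ := exists_isMultPAdicLFunctionOf_neg_one_of_nonsplit Dm.isNewformOf hmult hns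
  obtain ⟨s, u, -, hid⟩ := thm1_padicBSD_rankOne_multiplicative.nonsplit hD W p hp2 hmult hr1
    Dm.isNewformOf ϖ hϖpos.ne' hϖ hns hq0 hq1 hqj L hL Dh hDh
  have h1 : PowerSeries.coeff 1 L ≠ 0 := hc1 Dm.f Dm.isNewformOf L hL
  have hϖ0 : ((ϖ : ℚ) : ℚ_[p]) ≠ 0 := by exact_mod_cast hϖpos.ne'
  have hlog : padicLog p (cyclotomicGenerator p : ℚ_[p]) ≠ 0 :=
    Literature.Barriers.BirchSwinnertonDyer.padicLog_cyclotomicGenerator_ne_zero p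
  have hT : (W.torsionOrder : ℚ_[p]) ^ 2 ≠ 0 :=
    pow_ne_zero 2 (by exact_mod_cast (W.torsionOrder_pos_holds).ne')
  change padicRegulator Dh ≠ 0
  intro hReg
  have hz : ((ϖ : ℚ) : ℚ_[p]) * PowerSeries.coeff 1 L * padicLog p (cyclotomicGenerator p) *
      (W.torsionOrder : ℚ_[p]) ^ 2 = 0 := by
    rw [hid, hReg]; ring
  exact mul_ne_zero (mul_ne_zero (mul_ne_zero hϖ0 h1) hlog) hT hz

/-- **Converse bookkeeping: Schneider ⟹ `[T¹]L_p ≠ 0`** at a non-split multiplicative `p ≠ 2` in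
analytic rank one, for THE function of any newform `f` of `W` with a period ratio `ϖ ≠ 0`: the
right-hand side `u·2·#Ш_an·Reg_p·∏ c_v` of Disegni's identity (A183) is non-zero (`#Ш_an ≠ 0` by
`Disegni2020.shaAn_ne_zero_of_isNewformOf`). So on these pairs the certificate bit and the Schneider
input are ONE node. [cite: Disegni2020, Thm. 1 (§1.2)] [cite: Miller2011LMS, Def. 1.1] -/
theorem coeff_one_ne_zero_of_schneider_of_thm1 (hD : thm1_padicBSD_rankOne_multiplicative)
    (hp2 : p ≠ 2) (hmult : W.HasMultiplicativeReductionAtPrime p)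
    (hns : ¬ W.HasSplitMultiplicativeReductionAtPrime p) (hr1 : W.analyticRank = 1)
    {N : ℕ} [NeZero N] {f : CuspForm (Gamma0 N) 2} (hf : IsNewformOf W f)
    (ϖ : ℚ) (hϖ0 : ϖ ≠ 0) (hϖ : (ϖ : ℝ) * W.realPeriodRat = plusPeriod f)
    {q : ℚ_[p]} (hq0 : q ≠ 0) (hq1 : ‖q‖ < 1) (hqj : tateJ q = (W.j : ℚ_[p]))
    {L : PowerSeries ℚ_[p]} (hL : IsMultPAdicLFunctionOf f p (-1) L)
    (Dh : PAdicHeightData W p) (hDh : IsMultCanonical Dh q) (hSch : SchneiderConjecture Dh) :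
    PowerSeries.coeff 1 L ≠ 0 := by
  obtain ⟨s, u, hs, hid⟩ := thm1_padicBSD_rankOne_multiplicative.nonsplit hD W p hp2 hmult hr1 hf ϖ
    hϖ0 hϖ hns hq0 hq1 hqj L hL Dh hDh
  have hs0 : ((s : ℚ) : ℚ_[p]) ≠ 0 := by
    have : s ≠ 0 := by
      intro h0
      apply Disegni2020.shaAn_ne_zero_of_isNewformOf hf
      rw [hs, h0, Rat.cast_zero]
    exact_mod_cast this
  have hu : ((u : ℤ_[p]) : ℚ_[p]) ≠ 0 := by rw [Ne, PadicInt.coe_eq_zero]; exact u.ne_zero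
  have hcp : (W.tamagawaProduct : ℚ_[p]) ≠ 0 := by exact_mod_cast (W.tamagawaProduct_pos').ne'
  have hReg : padicRegulator Dh ≠ 0 := hSch
  have hR : ((u : ℤ_[p]) : ℚ_[p]) * (2 * ((s : ℚ_[p]) * padicRegulator Dh * W.tamagawaProduct)) ≠ 0 :=
    mul_ne_zero hu (mul_ne_zero two_ne_zero (mul_ne_zero (mul_ne_zero hs0 hReg) hcp))
  intro h1
  apply hR
  rw [← hid, h1, mul_zero, zero_mul, zero_mul]

/-- **Sub-cell `X2.CellCNonsplitGV` ∧ `[T¹]L_p ≠ 0` ⟹ `BSD(E,p)`** — p251198's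
`bsdp_of_cellC_of_not_split_of_gvPar_of_thm1_of_schneider` with its per-pair Schneider binder
DISCHARGED by the certificate bit (`schneider_of_coeff_one_ne_zero_of_thm1`). PUBLISHED named facts
only (A183 `hD`; GV00 at `p ‖ N` `hGV`, flag `GV00-mult-asserted`; Wuthrich Thm. 16 `hWu`; SW Thm. 6.1
`hJn`, §4.2 existence `hHn`; GZK; modularity) + ONE per-pair instrument-shaped input `hc1`.
CONDITIONAL; nothing booked; X2c stays CONSTRUCTION-SHAPED. [cite: Disegni2020, Thm. 1 (§1.2)]
[cite: GreenbergVatsal2000, Thm. (1.3) with pp. 1, 14–15] [cite: Wuthrich2014, Thm. 16 (p. 397)]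
[cite: SteinWuthrich2013, Thm. 6.1 (p. 20), §4.2] -/
theorem bsdp_of_cellC_of_not_split_of_gvPar_of_thm1_of_coeff_one_ne_zero
    (hD : thm1_padicBSD_rankOne_multiplicative) (hGV : lambdaMu_multiplicative_of_gvPar)
    (hWu : thm16_charIdeal_dvd_multiplicative_of_reducible) (hJn : thm61_nonsplitMultiplicative)
    (hHn : exists_isMultCanonical) (hGZK : rank_eq_analyticRank_of_analyticRank_le_one)
    (hpar : nonempty_modularParametrizationData) (hc : CellCNonsplitGV W p)
    (hc1 : ∀ {N : ℕ} [NeZero N] (f : CuspForm (Gamma0 N) 2), IsNewformOf W f →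
      ∀ (L : PowerSeries ℚ_[p]), IsMultPAdicLFunctionOf f p (-1) L → PowerSeries.coeff 1 L ≠ 0) :
    BSDp W p :=
  bsdp_of_cellC_of_not_split_of_gvPar_of_thm1_of_schneider W p hD hGV hWu hJn hHn hGZK hpar hc
    (fun _ Dh hq0 hq1 hqj hDh ↦ schneider_of_coeff_one_ne_zero_of_thm1 W p hD hpar hc.1.2.1
      hc.1.2.2.2 hc.2.1 hc.1.1 hc1 hq0 hq1 hqj Dh hDh)

/-- **X2c ∧ ¬split ∧ Mazur's MC at the pair ∧ `[T¹]L_p ≠ 0` ⟹ `BSD(E,p)`** — the whole non-split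
half of O9 with the certificate bit in place of the Schneider binder (the MC at the pair is
PUBLISHED on the gvpar sub-cell, above, and per pair by route G on the other,
`X2/CongruenceTransferRankOne.lean`). CONDITIONAL; nothing booked.
[cite: Disegni2020, Thm. 1 (§1.2)] [cite: SteinWuthrich2013, Thm. 6.1 (p. 20), §4.2] -/
theorem bsdp_of_cellC_of_not_split_of_mazurMainConjectureAt_of_thm1_of_coeff_one_ne_zero
    (hD : thm1_padicBSD_rankOne_multiplicative) (hJn : thm61_nonsplitMultiplicative)
    (hHn : exists_isMultCanonical) (hGZK : rank_eq_analyticRank_of_analyticRank_le_one)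
    (hpar : nonempty_modularParametrizationData)
    (hc : CellC W p) (hns : ¬ W.HasSplitMultiplicativeReductionAtPrime p)
    (hMC : MazurMainConjectureAt W p)
    (hc1 : ∀ {N : ℕ} [NeZero N] (f : CuspForm (Gamma0 N) 2), IsNewformOf W f →
      ∀ (L : PowerSeries ℚ_[p]), IsMultPAdicLFunctionOf f p (-1) L → PowerSeries.coeff 1 L ≠ 0) :
    BSDp W p :=
  bsdp_of_cellC_of_not_split_of_mazurMainConjectureAt_of_thm1_of_schneider W p hD hJn hHn hGZK hpar
    hc hns hMC
    (fun _ Dh hq0 hq1 hqj hDh ↦ schneider_of_coeff_one_ne_zero_of_thm1 W p hD hpar hc.2.1 hc.2.2.2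
      hns hc.1 hc1 hq0 hq1 hqj Dh hDh)

end Summit.BirchSwinnertonDyer.Rank1Residual.X2

end
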